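import Literature.MathematicalPhysics.QuantumFieldTheory.Balaban1983to89.Node00.HistoryTermIndexedGenerator

/-!
# NODE 00 (YM-PLAN Track A) — W1 = [II] §2 (2.13)–(2.14), STOREY 10: THE VERTEX TOWER AND THE INTERPOLATION TOWER OF A TERM-FUNCTIONAL FAMILY
# (`W1.vertexTower`, `W1.interpTF`, `W1.interpTower`, `W1.StepGen.CouplingBlind`; surgery on ONE step of `GenTower.ofTerms L TF` and its algebra)

NODE 00 DEFINER MODULE (seat `pub-ymgap-node00-def-W1`, generation 9, 2026-08-27).  APPEND-ONLY: a NEW importing module; g4's `Node00/HistoryRecursionOfRecord`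
(`StepGen`, `GenTower`, `recTerm`) and g6's `Node00/HistoryTermIndexedGenerator` (`TermFun`, `StepGen.ofTerms`, `GenTower.ofTerms`) untouched and CONSUMED BY NAME.
[II] = [Balaban1988RG2Cluster] T. Bałaban, *Renormalization group approach to lattice gauge field theories. II. Cluster expansions*, Commun. Math. Phys. **116**
(1988) 1–22; [I] = [Balaban1987RG1], part I, Commun. Math. Phys. **109** (1987) 249–301.

THE PIN.  The history dependence of the (2.14) terms ([I] p.263: `E^{(j)}(X; g₀, …, g_{j−1})`, «a C^∞-function of g_{j−1} ∈ [0, γ] (or analytic)»; [II]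
(2.13)–(2.14): step `k + 1` reads `g_k` and the OLDER TERMS) is compared, coupling by coupling, against a CENTRE: the generated history in which the term
functional of ONE step `i` is replaced by a centre functional `V` that does not read the coupling `g_i` (the «vertex value» of the step; an evaluation
`TF i … 0 …` at zero coupling is NOT a centre — the small-field thresholds `ε₁∕g` are junk at `g = 0` — so the centre is DATA, a coupling-blind functional).
THIS STOREY TYPES, over g6's `GenTower.ofTerms L TF`:
* §1 TOWER SURGERY ALGEBRA on g4's generic towers: `recTerm_congr_steps` (equal one-step maps at the read couplings below level `j` ⟹ equal terms up to
  `j`), `recTerm_updateStep_of_le ∕ _succ_self` (replacing step `i` leaves the levels `≤ i` and reads the ORIGINAL older terms at level `i + 1`),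
  `recTerm_updateHist_of_le ∕ _succ_self` (the history with `g_i := z`);
* §2 `StepGen.CouplingBlind G` ∕ `TermFun.CouplingBlind T` (the generic terms do not read the last coupling) with `recTerm_updateHist_of_couplingBlind`:
  if step `i` is coupling-blind, NO generated term reads `g_i`;
* §3 **`vertexTower L TF i V := GenTower.ofTerms L (Function.update TF i V)`** — THE VERTEX TOWER at coupling `i` with centre `V`, and its faces;
* §4 **`interpTF T V z₀ ρ := (Z, t, s, old, φ) ↦ V Z t z₀ old φ + (s∕ρ)·(T Z t z₀ old φ − V Z t z₀ old φ)`** — the INTERPOLATED term functional (mock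
  coupling `s` in the coupling slot, centre and endpoint read at the FIXED coupling `z₀`): `= V` at `s = 0`, `= T … z₀ …` at `s = ρ`, AFFINE (entire) in `s`,
  `‖·‖ ≤ ‖V‖ + (‖s‖∕ρ)·‖T z₀ − V‖` hence `≤ (1 + (R∕ρ)·δ)·W ≤ 2W` under a centred bound `‖T z₀ − V‖ ≤ δ·W`, `‖V‖ ≤ W`, `‖s‖ ≤ R`,
  `(R∕ρ)·δ ≤ 1`; and
  **`interpTower L TF i V z₀ ρ := vertexTower L TF i (interpTF (TF i) V z₀ ρ)`** with **`recTerm_interpTower_zero`** (mock coupling `0`: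
  the vertex tower's terms) and **`recTerm_interpTower_self`** (mock coupling `ρ`: the ACTUAL terms at `g_i := z₀`) — so a Cauchy estimate on
  `[0, ρ]` in the mock coupling compares actual and vertex terms at EVERY level (the Summit-side heredity of a centred letter rides on these two
  identities);
* §5 (one complex variable) a centred order-two letter on the window DETERMINES its centre (`tendsto_of_centredLetter`, `centre_unique`).
All faces are `rfl` ∕ `Function.update_self|_of_ne` ∕ strong induction on the creation step ∕ `Finset` algebra ∕ the triangle inequality.

HONEST FRAMING: definitions + kernel bookkeeping; NO estimate of Bałaban's; no holomorphy of any map of record is asserted (the affine interpolation is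
entire BY CONSTRUCTION, nothing more); the centre `V` and the term functional `TF` are DATA (no law); N22 ∕ N10 NOT discharged; K3⁗ untouched; counts
unmoved; one finite 𝕋⁴ programme at fixed ε, Bałaban as printed — NOT continuum ∕ ℝ⁴ ∕ infinite volume ∕ OS ∕ mass gap ∕ Clay.  No `sorry`, no `axiom`,
no `instance`, no `notation`.  §5 is adapted, with attribution, from the cell's lens memo `YMLens.Transfer8` (Sketch 8, T13′; memo-only, never landed).

References (TYPES and page anchors only): [II] (2.9)–(2.14) pp.14–15, (2.26) p.17; [I] (0.23) p.256, §1 p.263, p.266, (2.12)–(2.13) p.268.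
-/

open scoped BigOperators

noncomputable section

namespace Literature.MathematicalPhysics.QuantumFieldTheory.Balaban1983to89.Node00

open Literature.MathematicalPhysics.QuantumFieldTheory.Balaban1983to89
open Step B14.Eq213MaximalDomains TreeLengthTorus T4Continuum Sect2
open Literature.MathematicalPhysics.QuantumFieldTheory.Balaban1983to89.TreeLengthTorusGeometry (tgeometry)
open Literature.MathematicalPhysics.QuantumFieldTheory.Balaban1983to89.B13Lemma3TorusTerms (terms)

namespace W1

/-! ## §1  Tower surgery algebra: congruence of generated terms, replacing one step, updating one coupling -/

section Surgery

variable {P : Params} {𝔸 : Type*} {M : ℕ}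

/-- **CONGRUENCE OF THE GENERATED TERMS**: two towers at two histories whose one-step maps AGREE at the read couplings at every step `k < j` (for
all older terms and configurations) generate the same terms up to level `j` — strong induction on the creation step ((2.13) reads step `k`'s map at
`g_k` and the older terms only). [cite: Balaban1987RG1, (0.23) p.256 and (2.12)-(2.13) p.268; Balaban1988RG2Cluster, (2.13)-(2.14) pp.14-15] -/
theorem recTerm_congr_steps (G G' : GenTower P 𝔸 M) {g g' : ℕ → ℂ} :
    ∀ (j : ℕ), (∀ k < j, ∀ (old : OlderTerms P 𝔸 M k) (φ : CPair P 𝔸) (X : (domSys P M (k + 1)).Dom),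
      (G k).E (g k) old φ X = (G' k).E (g' k) old φ X) →
      ∀ (X : (domSys P M j).Dom) (φ : CPair P 𝔸), recTerm G g j X φ = recTerm G' g' j X φ := by
  intro j
  induction j using Nat.strong_induction_on with
  | _ j ih =>
    intro h X φ
    cases j with
    | zero => simp
    | succ k =>
      rw [recTerm_succ, recTerm_succ]
      have hold : olderOf (recTerm G g) k = olderOf (recTerm G' g') k :=
        funext fun j' => funext fun Y => funext fun ψ => by
          rw [olderOf_apply, olderOf_apply]
          exact ih j'.1 j'.2 (fun k' hk' => h k' (lt_trans hk' j'.2)) Y ψ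
      rw [hold]
      exact h k (Nat.lt_succ_self k) _ φ X

/-- Towers agreeing at the steps `k < j` generate the same terms up to level `j` (same history). [cite: Balaban1987RG1, (2.12)-(2.13) p.268 (bookkeeping)] -/
theorem recTerm_congr_tower (G G' : GenTower P 𝔸 M) (g : ℕ → ℂ) (j : ℕ) (h : ∀ k < j, G k = G' k) (X : (domSys P M j).Dom) (φ : CPair P 𝔸) :
    recTerm G g j X φ = recTerm G' g j X φ :=
  recTerm_congr_steps G G' j (fun k hk old ψ Y => by rw [h k hk]) X φ

/-- **REPLACING STEP `i` LEAVES THE LEVELS `≤ i`** (they are created by the steps `< i`). [cite: Balaban1987RG1, (0.23) p.256 and (2.13) p.268 (bookkeeping)] -/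
theorem recTerm_updateStep_of_le (G : GenTower P 𝔸 M) {i : ℕ} (G' : StepGen P 𝔸 M i) (g : ℕ → ℂ) {j : ℕ} (h : j ≤ i)
    (X : (domSys P M j).Dom) (φ : CPair P 𝔸) : recTerm (Function.update G i G') g j X φ = recTerm G g j X φ :=
  recTerm_congr_tower _ G g j (fun _ hk => Function.update_of_ne (Nat.ne_of_lt (lt_of_lt_of_le hk h)) G' G) X φ

/-- **THE REPLACED STEP READS THE ORIGINAL OLDER TERMS**: with step `i` replaced by `G'`, the level-`(i+1)` term is `G'`'s one-step map at `g_i` and the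
older terms OF `G`. [cite: Balaban1987RG1, (2.12)-(2.13) p.268; Balaban1988RG2Cluster, (2.13)-(2.14) pp.14-15] -/
theorem recTerm_updateStep_succ_self (G : GenTower P 𝔸 M) {i : ℕ} (G' : StepGen P 𝔸 M i) (g : ℕ → ℂ) (X : (domSys P M (i + 1)).Dom) (φ : CPair P 𝔸) :
    recTerm (Function.update G i G') g (i + 1) X φ = G'.E (g i) (olderOf (recTerm G g) i) φ X := by
  rw [recTerm_succ, Function.update_self]
  refine congrArg (fun old => G'.E (g i) old φ X) (funext fun j' => funext fun Y => funext fun ψ => ?_)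
  rw [olderOf_apply, olderOf_apply]
  exact recTerm_updateStep_of_le G G' g (Nat.le_of_lt_succ j'.2) Y ψ

/-- Updating the coupling `g_i` leaves the levels `≤ i` (prefix dependence, `recTerm_congr_prefix`). [cite: Balaban1987RG1, §0 p.256 and (2.13) p.268 (bookkeeping)] -/
theorem recTerm_updateHist_of_le (G : GenTower P 𝔸 M) (g : ℕ → ℂ) {i : ℕ} (z : ℂ) {j : ℕ} (h : j ≤ i) (X : (domSys P M j).Dom) (φ : CPair P 𝔸) :
    recTerm G (Function.update g i z) j X φ = recTerm G g j X φ :=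
  recTerm_congr_prefix G j (fun _ hn => Function.update_of_ne (Nat.ne_of_lt (lt_of_lt_of_le hn h)) z g) X φ

/-- **THE SECTION IN THE LAST COUPLING IS THE ONE-STEP MAP AT THE FROZEN OLDER TERMS**: `E^{(i+1)}(X; g|g_i:=z; φ) = (step i)(z, (E^{(j)}(g))_{j≤i})(X; φ)`
([I] p.263 «C^∞-function of g_{j−1} … (or analytic)» read on the recursion). [cite: Balaban1987RG1, §1 p.263 and (2.12)-(2.13) p.268; Balaban1988RG2Cluster, (2.14) p.15] -/
theorem recTerm_updateHist_succ_self (G : GenTower P 𝔸 M) (g : ℕ → ℂ) (i : ℕ) (z : ℂ) (X : (domSys P M (i + 1)).Dom) (φ : CPair P 𝔸) :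
    recTerm G (Function.update g i z) (i + 1) X φ = (G i).E z (olderOf (recTerm G g) i) φ X := by
  rw [recTerm_succ, Function.update_self]
  refine congrArg (fun old => (G i).E z old φ X) (funext fun j' => funext fun Y => funext fun ψ => ?_)
  rw [olderOf_apply, olderOf_apply]
  exact recTerm_updateHist_of_le G g z (Nat.le_of_lt_succ j'.2) Y ψ

end Surgery

/-! ## §2  Coupling-blind steps and term functionals (the centre does not read the coupling) -/

section Blind

variable {P : Params} {𝔸 : Type*} {M : ℕ} {k : ℕ}

/-- **A COUPLING-BLIND STEP**: its generic terms do not read the last coupling (the shape of a CENTRE ∕ vertex-value step: [I] p.263's dependence on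
`g_{j−1}` is trivial). [cite: Balaban1987RG1, §1 p.263 (dependence on g_{j-1}); Balaban1988RG2Cluster, (2.14) p.15] -/
def StepGen.CouplingBlind (G : StepGen P 𝔸 M k) : Prop :=
  ∀ (i : G.Idx) (t t' : ℂ) (old : OlderTerms P 𝔸 M k) (φ : CPair P 𝔸), G.T i t old φ = G.T i t' old φ

/-- A coupling-blind step has coupling-blind activities. [cite: Balaban1988RG2Cluster, (2.9)-(2.11) p.14 (bookkeeping)] -/
theorem StepGen.CouplingBlind.H_eq {G : StepGen P 𝔸 M k} (h : G.CouplingBlind) (t t' : ℂ) (old : OlderTerms P 𝔸 M k) (φ : CPair P 𝔸)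
    (Z : (domSys P M (k + 1)).Dom) : G.H t old φ Z = G.H t' old φ Z := by
  unfold StepGen.H
  exact Finset.sum_congr rfl fun i _ => h i t t' old φ

/-- … and a coupling-blind one-step map (2.13). [cite: Balaban1988RG2Cluster, (2.13) p.14 (bookkeeping)] -/
theorem StepGen.CouplingBlind.E_eq {G : StepGen P 𝔸 M k} (h : G.CouplingBlind) (t t' : ℂ) (old : OlderTerms P 𝔸 M k) (φ : CPair P 𝔸)
    (X : (domSys P M (k + 1)).Dom) : G.E t old φ X = G.E t' old φ X :=
  G.E_congr X fun Z => h.H_eq t t' old φ Z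

/-- **IF STEP `i` IS COUPLING-BLIND, NO GENERATED TERM READS `g_i`** (the levels `≤ i` never do; level `i + 1` reads it through the blind step; the higher
levels through the older terms only). [cite: Balaban1987RG1, §0 p.256 and (2.12)-(2.13) p.268; Balaban1988RG2Cluster, (2.13)-(2.14) pp.14-15] -/
theorem recTerm_updateHist_of_couplingBlind (G : GenTower P 𝔸 M) {i : ℕ} (h : (G i).CouplingBlind) (g : ℕ → ℂ) (z : ℂ) (j : ℕ)
    (X : (domSys P M j).Dom) (φ : CPair P 𝔸) : recTerm G (Function.update g i z) j X φ = recTerm G g j X φ := by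
  refine recTerm_congr_steps G G j (fun k _ old ψ Y => ?_) X φ
  rcases eq_or_ne k i with rfl | hk
  · rw [Function.update_self]
    exact h.E_eq z (g k) old ψ Y
  · rw [Function.update_of_ne hk]

variable {L : ℕ} [NeZero L]

/-- **A COUPLING-BLIND TERM FUNCTIONAL**: no (2.14) term of it reads the last coupling — the typing of a CENTRE (vertex-value) functional; an evaluation at
zero coupling is not one unless it is the window limit (§5). [cite: Balaban1988RG2Cluster, (2.14) p.15; Balaban1987RG1, §1 p.263] -/
def TermFun.CouplingBlind (T : TermFun P 𝔸 M k L) : Prop :=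
  ∀ (Z : (domSys P M (k + 1)).Dom) (t : TermLabel P M k L) (s s' : ℂ) (old : OlderTerms P 𝔸 M k) (φ : CPair P 𝔸), T Z t s old φ = T Z t s' old φ

/-- The term functional of a coupling-free value table (the canonical centre shape; `reducible`, so that a consumer's literal
`fun Z t _ old φ => V₀ Z t old φ` IS it). [cite: Balaban1988RG2Cluster, (2.14) p.15 (bookkeeping)] -/
@[reducible] def TermFun.ofBlind (V₀ : (domSys P M (k + 1)).Dom → TermLabel P M k L → OlderTerms P 𝔸 M k → CPair P 𝔸 → ℂ) : TermFun P 𝔸 M k L :=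
  fun Z t _ old φ => V₀ Z t old φ

/-- `TermFun.ofBlind V₀` is coupling-blind (`rfl`). [cite: Balaban1988RG2Cluster, (2.14) p.15 (bookkeeping)] -/
theorem couplingBlind_ofBlind (V₀ : (domSys P M (k + 1)).Dom → TermLabel P M k L → OlderTerms P 𝔸 M k → CPair P 𝔸 → ℂ) :
    (TermFun.ofBlind V₀).CouplingBlind := fun _ _ _ _ _ _ => rfl

variable [NeZero M] (L)

/-- The term-indexed step of a coupling-blind term functional is coupling-blind. [cite: Balaban1988RG2Cluster, (2.9)-(2.11) p.14 and (2.14) p.15 (bookkeeping)] -/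
theorem couplingBlind_ofTerms {T : TermFun P 𝔸 M k L} (h : T.CouplingBlind) : (StepGen.ofTerms L T).CouplingBlind :=
  fun i t t' old φ => h i.1 i.2 t t' old φ

open Classical in
/-- **PER-TERM CONGRUENCE ⟹ CONGRUENCE OF (2.13) ACROSS TERM FUNCTIONALS** (if every term of every `Z` takes the same value at the two argument triples, the
two term-indexed steps create the same `E^{(k+1)}(X)`). [cite: Balaban1988RG2Cluster, (2.9)-(2.13) p.14 (bookkeeping)] -/
theorem E_ofTerms_congr {T T' : TermFun P 𝔸 M k L} {t t' : ℂ} {old old' : OlderTerms P 𝔸 M k} {φ φ' : CPair P 𝔸} (X : (domSys P M (k + 1)).Dom)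
    (h : ∀ (Z : (domSys P M (k + 1)).Dom), ∀ s ∈ terms L M Z, T Z s t old φ = T' Z s t' old' φ') :
    (StepGen.ofTerms L T).E t old φ X = (StepGen.ofTerms L T').E t' old' φ' X := by
  unfold StepGen.E
  exact congrArg (fun w => B13Resummation.locE _ (tgeometry P.d (domCount P M (k + 1))).cubes w (Subtype.val X))
    (funext fun Z => H_ofTerms_congr L Z (h Z))

end Blind

/-! ## §3  The vertex tower: step `i`'s term functional replaced by a centre -/

section Vertex

variable {P : Params} {𝔸 : Type*} {M : ℕ} [NeZero M] (L : ℕ) [NeZero L]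

/-- **THE VERTEX TOWER AT COUPLING `i` WITH CENTRE `V`**: the generator tower of the term-functional family with step `i`'s functional replaced by `V`
(every other step as in `GenTower.ofTerms L TF`). [cite: Balaban1988RG2Cluster, (2.13)-(2.14) pp.14-15; Balaban1987RG1, §1 p.263 and (2.12)-(2.13) p.268] -/
def vertexTower (TF : GenTermFun P 𝔸 M L) (i : ℕ) (V : TermFun P 𝔸 M i L) : GenTower P 𝔸 M :=
  GenTower.ofTerms L (Function.update TF i V)

/-- The vertex tower is `GenTower.ofTerms L TF` with step `i` updated. [cite: Balaban1987RG1, (2.12)-(2.13) p.268 (bookkeeping)] -/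
theorem vertexTower_eq_update (TF : GenTermFun P 𝔸 M L) (i : ℕ) (V : TermFun P 𝔸 M i L) :
    vertexTower L TF i V = Function.update (GenTower.ofTerms L TF) i (StepGen.ofTerms L V) := by
  funext k
  by_cases hk : k = i
  · subst hk
    rw [Function.update_self]
    exact congrArg (StepGen.ofTerms L) (Function.update_self k V TF)
  · rw [Function.update_of_ne hk]
    exact congrArg (StepGen.ofTerms L) (Function.update_of_ne hk V TF)

/-- Face: step `i` of the vertex tower is the centre's term-indexed step. [cite: Balaban1988RG2Cluster, (2.14) p.15 (bookkeeping)] -/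
theorem vertexTower_apply_self (TF : GenTermFun P 𝔸 M L) (i : ℕ) (V : TermFun P 𝔸 M i L) : vertexTower L TF i V i = StepGen.ofTerms L V :=
  congrArg (StepGen.ofTerms L) (Function.update_self i V TF)

/-- Face: the other steps are those of `GenTower.ofTerms L TF`. [cite: Balaban1988RG2Cluster, (2.14) p.15 (bookkeeping)] -/
theorem vertexTower_apply_of_ne (TF : GenTermFun P 𝔸 M L) {i k : ℕ} (V : TermFun P 𝔸 M i L) (h : k ≠ i) :
    vertexTower L TF i V k = StepGen.ofTerms L (TF k) :=
  congrArg (StepGen.ofTerms L) (Function.update_of_ne h V TF)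

/-- Honesty: centring at the step's own functional changes nothing. [cite: Balaban1987RG1, (2.12)-(2.13) p.268 (bookkeeping)] -/
theorem vertexTower_self (TF : GenTermFun P 𝔸 M L) (i : ℕ) : vertexTower L TF i (TF i) = GenTower.ofTerms L TF :=
  congrArg (GenTower.ofTerms L) (Function.update_eq_self i TF)

/-- **THE VERTEX TOWER HAS THE SAME TERMS AT THE LEVELS `≤ i`.** [cite: Balaban1987RG1, (0.23) p.256 and (2.13) p.268 (bookkeeping)] -/
theorem recTerm_vertexTower_of_le (TF : GenTermFun P 𝔸 M L) (i : ℕ) (V : TermFun P 𝔸 M i L) (g : ℕ → ℂ) {j : ℕ} (h : j ≤ i)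
    (X : (domSys P M j).Dom) (φ : CPair P 𝔸) : recTerm (vertexTower L TF i V) g j X φ = recTerm (GenTower.ofTerms L TF) g j X φ := by
  rw [vertexTower_eq_update]
  exact recTerm_updateStep_of_le _ _ g h X φ

/-- **THE VERTEX TERM AT LEVEL `i + 1`**: the centre's (2.13) at `g_i` and the ORIGINAL older terms. [cite: Balaban1988RG2Cluster, (2.13)-(2.14) pp.14-15; Balaban1987RG1, (2.13) p.268] -/
theorem recTerm_vertexTower_succ_self (TF : GenTermFun P 𝔸 M L) (i : ℕ) (V : TermFun P 𝔸 M i L) (g : ℕ → ℂ) (X : (domSys P M (i + 1)).Dom)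
    (φ : CPair P 𝔸) : recTerm (vertexTower L TF i V) g (i + 1) X φ = (StepGen.ofTerms L V).E (g i) (olderOf (recTerm (GenTower.ofTerms L TF) g) i) φ X := by
  rw [vertexTower_eq_update]
  exact recTerm_updateStep_succ_self _ _ g X φ

/-- **WITH A COUPLING-BLIND CENTRE NO VERTEX-TOWER TERM READS `g_i`.** [cite: Balaban1987RG1, §1 p.263 and (2.13) p.268; Balaban1988RG2Cluster, (2.14) p.15] -/
theorem recTerm_vertexTower_updateHist (TF : GenTermFun P 𝔸 M L) (i : ℕ) {V : TermFun P 𝔸 M i L} (hV : V.CouplingBlind) (g : ℕ → ℂ) (z : ℂ)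
    (j : ℕ) (X : (domSys P M j).Dom) (φ : CPair P 𝔸) : recTerm (vertexTower L TF i V) (Function.update g i z) j X φ = recTerm (vertexTower L TF i V) g j X φ :=
  recTerm_updateHist_of_couplingBlind _ (by rw [vertexTower_apply_self]; exact couplingBlind_ofTerms L hV) g z j X φ

end Vertex

/-! ## §4  The interpolated term functional and the interpolation tower -/

section Interp

variable {P : Params} {𝔸 : Type*} {M : ℕ} {k : ℕ} {L : ℕ} [NeZero L]

/-- **THE INTERPOLATED TERM FUNCTIONAL** between the centre `V` (mock coupling `s = 0`) and the functional `T` read at the FIXED coupling `z₀` (mock coupling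
`s = ρ`): `V + (s∕ρ)·(T z₀ − V)`, the centre also read at `z₀` (immaterial for a coupling-blind centre) so that every face is hypothesis-free.
[cite: Balaban1988RG2Cluster, (2.14) p.15; Balaban1987RG1, §1 p.263 (dependence on g_{j-1})] -/
def interpTF (T V : TermFun P 𝔸 M k L) (z₀ : ℂ) (ρ : ℝ) : TermFun P 𝔸 M k L :=
  fun Z t s old φ => V Z t z₀ old φ + s / (ρ : ℂ) * (T Z t z₀ old φ - V Z t z₀ old φ)

/-- Face (`rfl`). [cite: Balaban1988RG2Cluster, (2.14) p.15 (bookkeeping)] -/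
theorem interpTF_apply (T V : TermFun P 𝔸 M k L) (z₀ : ℂ) (ρ : ℝ) (Z : (domSys P M (k + 1)).Dom) (t : TermLabel P M k L) (s : ℂ)
    (old : OlderTerms P 𝔸 M k) (φ : CPair P 𝔸) : interpTF T V z₀ ρ Z t s old φ = V Z t z₀ old φ + s / (ρ : ℂ) * (T Z t z₀ old φ - V Z t z₀ old φ) := rfl

/-- **AT MOCK COUPLING `0`: THE CENTRE.** [cite: Balaban1988RG2Cluster, (2.14) p.15 (bookkeeping)] -/
theorem interpTF_zero (T V : TermFun P 𝔸 M k L) (z₀ : ℂ) (ρ : ℝ) (Z : (domSys P M (k + 1)).Dom) (t : TermLabel P M k L) (old : OlderTerms P 𝔸 M k)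
    (φ : CPair P 𝔸) : interpTF T V z₀ ρ Z t 0 old φ = V Z t z₀ old φ := by
  rw [interpTF_apply, zero_div, zero_mul, add_zero]

/-- **AT MOCK COUPLING `ρ ≠ 0`: THE FUNCTIONAL AT `z₀`.** [cite: Balaban1988RG2Cluster, (2.14) p.15 (bookkeeping)] -/
theorem interpTF_self (T V : TermFun P 𝔸 M k L) (z₀ : ℂ) {ρ : ℝ} (hρ : ρ ≠ 0) (Z : (domSys P M (k + 1)).Dom) (t : TermLabel P M k L)
    (old : OlderTerms P 𝔸 M k) (φ : CPair P 𝔸) : interpTF T V z₀ ρ Z t (ρ : ℂ) old φ = T Z t z₀ old φ := by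
  rw [interpTF_apply, div_self (Complex.ofReal_ne_zero.2 hρ), one_mul, add_sub_cancel]

/-- The increment over the centre is `(s∕ρ)·(T z₀ − V)`. [cite: Balaban1988RG2Cluster, (2.14) p.15 (bookkeeping)] -/
theorem interpTF_sub_centre (T V : TermFun P 𝔸 M k L) (z₀ : ℂ) (ρ : ℝ) (Z : (domSys P M (k + 1)).Dom) (t : TermLabel P M k L) (s : ℂ)
    (old : OlderTerms P 𝔸 M k) (φ : CPair P 𝔸) : interpTF T V z₀ ρ Z t s old φ - V Z t z₀ old φ = s / (ρ : ℂ) * (T Z t z₀ old φ - V Z t z₀ old φ) := by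
  rw [interpTF_apply, add_sub_cancel_left]

/-- Honesty: centred at itself the interpolation is constant in the mock coupling. [cite: Balaban1988RG2Cluster, (2.14) p.15 (bookkeeping)] -/
theorem interpTF_self_centre (T : TermFun P 𝔸 M k L) (z₀ : ℂ) (ρ : ℝ) (Z : (domSys P M (k + 1)).Dom) (t : TermLabel P M k L) (s : ℂ)
    (old : OlderTerms P 𝔸 M k) (φ : CPair P 𝔸) : interpTF T T z₀ ρ Z t s old φ = T Z t z₀ old φ := by
  rw [interpTF_apply, sub_self, mul_zero, add_zero]

/-- Per-term localisation transfers: equal centre and endpoint values at two (older terms, configuration) pairs give equal interpolated values.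
[cite: Balaban1988RG2Cluster, (2.9)-(2.11) p.14 (bookkeeping)] -/
theorem interpTF_congr_old (T V : TermFun P 𝔸 M k L) (z₀ : ℂ) (ρ : ℝ) (Z : (domSys P M (k + 1)).Dom) (t : TermLabel P M k L) (s : ℂ)
    {old old' : OlderTerms P 𝔸 M k} {φ φ' : CPair P 𝔸} (hT : T Z t z₀ old φ = T Z t z₀ old' φ') (hV : V Z t z₀ old φ = V Z t z₀ old' φ') :
    interpTF T V z₀ ρ Z t s old φ = interpTF T V z₀ ρ Z t s old' φ' := by
  rw [interpTF_apply, interpTF_apply, hT, hV]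

/-- **THE INTERPOLATION IS HOLOMORPHIC ALONG ANY CURVE** `w ↦ (u w, cv w, cφ w)` in (mock coupling, older terms, configuration) along which the mock coupling
and the centre's and endpoint's values are (affine in the mock coupling). [cite: Balaban1987RG1, §1 p.263 and p.266; Balaban1988RG2Cluster, (2.14) p.15 and (2.26) p.17] -/
theorem differentiableOn_interpTF (T V : TermFun P 𝔸 M k L) (z₀ : ℂ) (ρ : ℝ) (Z : (domSys P M (k + 1)).Dom) (t : TermLabel P M k L) {D : Set ℂ}
    {u : ℂ → ℂ} {cv : ℂ → OlderTerms P 𝔸 M k} {cφ : ℂ → CPair P 𝔸} (hu : DifferentiableOn ℂ u D)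
    (hT : DifferentiableOn ℂ (fun w => T Z t z₀ (cv w) (cφ w)) D) (hV : DifferentiableOn ℂ (fun w => V Z t z₀ (cv w) (cφ w)) D) :
    DifferentiableOn ℂ (fun w => interpTF T V z₀ ρ Z t (u w) (cv w) (cφ w)) D :=
  hV.add ((hu.div_const _).mul (hT.sub hV))

/-- In the mock coupling alone (older terms and configuration frozen) the interpolation is ENTIRE. [cite: Balaban1987RG1, §1 p.263 («or analytic» in g_{j-1}); Balaban1988RG2Cluster, (2.14) p.15] -/
theorem differentiable_interpTF (T V : TermFun P 𝔸 M k L) (z₀ : ℂ) (ρ : ℝ) (Z : (domSys P M (k + 1)).Dom) (t : TermLabel P M k L)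
    (old : OlderTerms P 𝔸 M k) (φ : CPair P 𝔸) : Differentiable ℂ (fun s => interpTF T V z₀ ρ Z t s old φ) :=
  (differentiable_const _).add ((differentiable_id.div_const _).mul (differentiable_const _))

/-- … hence analytic on every set (the `AnalyticOnNhd` currency of g4's (A-last)). [cite: Balaban1987RG1, §1 p.263 and p.266; Balaban1988RG2Cluster, (2.14) p.15] -/
theorem analyticOnNhd_interpTF (T V : TermFun P 𝔸 M k L) (z₀ : ℂ) (ρ : ℝ) (Z : (domSys P M (k + 1)).Dom) (t : TermLabel P M k L)
    (old : OlderTerms P 𝔸 M k) (φ : CPair P 𝔸) (D : Set ℂ) : AnalyticOnNhd ℂ (fun s => interpTF T V z₀ ρ Z t s old φ) D :=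
  fun z _ => (differentiable_interpTF T V z₀ ρ Z t old φ).analyticAt z

/-- **THE NORM FACE**: `‖V + (s∕ρ)(T z₀ − V)‖ ≤ ‖V‖ + (‖s‖∕ρ)·‖T z₀ − V‖`. [cite: Balaban1988RG2Cluster, (2.14) p.15 and (2.26) p.17 (the triangle inequality)] -/
theorem norm_interpTF_le (T V : TermFun P 𝔸 M k L) (z₀ : ℂ) {ρ : ℝ} (hρ : 0 < ρ) (Z : (domSys P M (k + 1)).Dom) (t : TermLabel P M k L) (s : ℂ)
    (old : OlderTerms P 𝔸 M k) (φ : CPair P 𝔸) :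
    ‖interpTF T V z₀ ρ Z t s old φ‖ ≤ ‖V Z t z₀ old φ‖ + ‖s‖ / ρ * ‖T Z t z₀ old φ - V Z t z₀ old φ‖ := by
  rw [interpTF_apply]
  refine (norm_add_le _ _).trans (le_of_eq ?_)
  rw [norm_mul, norm_div, Complex.norm_real, Real.norm_of_nonneg hρ.le]

/-- **THE CENTRED WEIGHT BOUND**: under `‖V‖ ≤ W`, a centred bound `‖T z₀ − V‖ ≤ δ·W` (Summit side: `δ = M_v‖z₀‖²`) and `‖s‖ ≤ R`, the interpolated term
is bounded by `(1 + (R∕ρ)·δ)·W` — the weight of the interpolation tower's step `i` on the mock disc `‖s‖ ≤ R`.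
[cite: Balaban1988RG2Cluster, (2.14) p.15 and (2.26) p.17; Balaban1987RG1, (1.18) p.263] -/
theorem norm_interpTF_le_of_centred (T V : TermFun P 𝔸 M k L) (z₀ : ℂ) {ρ : ℝ} (hρ : 0 < ρ) (Z : (domSys P M (k + 1)).Dom) (t : TermLabel P M k L)
    {s : ℂ} (old : OlderTerms P 𝔸 M k) (φ : CPair P 𝔸) {W δ R : ℝ} (hV : ‖V Z t z₀ old φ‖ ≤ W)
    (hc : ‖T Z t z₀ old φ - V Z t z₀ old φ‖ ≤ δ * W) (hs : ‖s‖ ≤ R) : ‖interpTF T V z₀ ρ Z t s old φ‖ ≤ (1 + R / ρ * δ) * W := by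
  have h2 : ‖s‖ / ρ * ‖T Z t z₀ old φ - V Z t z₀ old φ‖ ≤ R / ρ * (δ * W) :=
    mul_le_mul (div_le_div_of_nonneg_right hs hρ.le) hc (norm_nonneg _) (div_nonneg ((norm_nonneg s).trans hs) hρ.le)
  calc ‖interpTF T V z₀ ρ Z t s old φ‖ ≤ ‖V Z t z₀ old φ‖ + ‖s‖ / ρ * ‖T Z t z₀ old φ - V Z t z₀ old φ‖ := norm_interpTF_le T V z₀ hρ Z t s old φ
    _ ≤ W + R / ρ * (δ * W) := add_le_add hV h2
    _ = (1 + R / ρ * δ) * W := by ring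

/-- … and by `2·W` when `(R∕ρ)·δ ≤ 1` (the slack-two weight step: `2·e^{a|Z|} ≤ e^{a′|Z|}` is the consumer's numerics).
[cite: Balaban1988RG2Cluster, (2.26) p.17; Balaban1987RG1, (1.18) p.263] -/
theorem norm_interpTF_le_two_mul (T V : TermFun P 𝔸 M k L) (z₀ : ℂ) {ρ : ℝ} (hρ : 0 < ρ) (Z : (domSys P M (k + 1)).Dom) (t : TermLabel P M k L)
    {s : ℂ} (old : OlderTerms P 𝔸 M k) (φ : CPair P 𝔸) {W δ R : ℝ} (hW : 0 ≤ W) (hV : ‖V Z t z₀ old φ‖ ≤ W)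
    (hc : ‖T Z t z₀ old φ - V Z t z₀ old φ‖ ≤ δ * W) (hs : ‖s‖ ≤ R) (hsmall : R / ρ * δ ≤ 1) : ‖interpTF T V z₀ ρ Z t s old φ‖ ≤ 2 * W :=
  (norm_interpTF_le_of_centred T V z₀ hρ Z t old φ hV hc hs).trans (mul_le_mul_of_nonneg_right (by linarith) hW)

variable [NeZero M] (L)

/-- **THE INTERPOLATED STEP'S ACTIVITY IS AFFINE IN THE MOCK COUPLING**: `H_s(Z) = H_V(Z) + (s∕ρ)·(H_T(Z)|_{z₀} − H_V(Z))` (finite sums). (`E = locE ∘ H` is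
not affine; its holomorphy in `s` from `H`'s is the consumer's.) [cite: Balaban1988RG2Cluster, (2.9)-(2.11) p.14 and (2.14) p.15] -/
theorem H_ofTerms_interpTF (T V : TermFun P 𝔸 M k L) (z₀ : ℂ) (ρ : ℝ) (s : ℂ) (old : OlderTerms P 𝔸 M k) (φ : CPair P 𝔸) (Z : (domSys P M (k + 1)).Dom) :
    (StepGen.ofTerms L (interpTF T V z₀ ρ)).H s old φ Z = (StepGen.ofTerms L V).H z₀ old φ Z +
      s / (ρ : ℂ) * ((StepGen.ofTerms L T).H z₀ old φ Z - (StepGen.ofTerms L V).H z₀ old φ Z) := by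
  rw [ofTerms_H, ofTerms_H, ofTerms_H, ← Finset.sum_sub_distrib, Finset.mul_sum, ← Finset.sum_add_distrib]
  rfl

/-- **THE INTERPOLATION TOWER** at coupling `i`, centre `V`, endpoint coupling `z₀`, mock radius `ρ`: the vertex tower with centre the interpolated functional
of step `i`. [cite: Balaban1988RG2Cluster, (2.13)-(2.14) pp.14-15; Balaban1987RG1, §1 p.263 and (2.12)-(2.13) p.268] -/
def interpTower (TF : GenTermFun P 𝔸 M L) (i : ℕ) (V : TermFun P 𝔸 M i L) (z₀ : ℂ) (ρ : ℝ) : GenTower P 𝔸 M :=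
  vertexTower L TF i (interpTF (TF i) V z₀ ρ)

/-- Face: step `i` of the interpolation tower. [cite: Balaban1988RG2Cluster, (2.14) p.15 (bookkeeping)] -/
theorem interpTower_apply_self (TF : GenTermFun P 𝔸 M L) (i : ℕ) (V : TermFun P 𝔸 M i L) (z₀ : ℂ) (ρ : ℝ) :
    interpTower L TF i V z₀ ρ i = StepGen.ofTerms L (interpTF (TF i) V z₀ ρ) :=
  vertexTower_apply_self L _ i _

/-- Face: the other steps are those of `GenTower.ofTerms L TF`. [cite: Balaban1988RG2Cluster, (2.14) p.15 (bookkeeping)] -/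
theorem interpTower_apply_of_ne (TF : GenTermFun P 𝔸 M L) {i k : ℕ} (V : TermFun P 𝔸 M i L) (z₀ : ℂ) (ρ : ℝ) (h : k ≠ i) :
    interpTower L TF i V z₀ ρ k = StepGen.ofTerms L (TF k) :=
  vertexTower_apply_of_ne L _ _ h

/-- The interpolation tower has the same terms at the levels `≤ i`. [cite: Balaban1987RG1, (0.23) p.256 and (2.13) p.268 (bookkeeping)] -/
theorem recTerm_interpTower_of_le (TF : GenTermFun P 𝔸 M L) (i : ℕ) (V : TermFun P 𝔸 M i L) (z₀ : ℂ) (ρ : ℝ) (g : ℕ → ℂ) {j : ℕ} (h : j ≤ i)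
    (X : (domSys P M j).Dom) (φ : CPair P 𝔸) : recTerm (interpTower L TF i V z₀ ρ) g j X φ = recTerm (GenTower.ofTerms L TF) g j X φ :=
  recTerm_vertexTower_of_le L TF i _ g h X φ

/-- **THE SECTION OF THE INTERPOLATION TOWER IN THE MOCK COUPLING AT LEVEL `i + 1`** is the interpolated step's (2.13) at the frozen ORIGINAL older terms
(whose activity is affine in `s`, `H_ofTerms_interpTF`). [cite: Balaban1988RG2Cluster, (2.13)-(2.14) pp.14-15; Balaban1987RG1, §1 p.263] -/
theorem recTerm_interpTower_succ_self (TF : GenTermFun P 𝔸 M L) (i : ℕ) (V : TermFun P 𝔸 M i L) (z₀ : ℂ) (ρ : ℝ) (g : ℕ → ℂ) (s : ℂ)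
    (X : (domSys P M (i + 1)).Dom) (φ : CPair P 𝔸) : recTerm (interpTower L TF i V z₀ ρ) (Function.update g i s) (i + 1) X φ =
      (StepGen.ofTerms L (interpTF (TF i) V z₀ ρ)).E s (olderOf (recTerm (GenTower.ofTerms L TF) g) i) φ X := by
  rw [recTerm_updateHist_succ_self, interpTower_apply_self]
  refine congrArg (fun old => (StepGen.ofTerms L (interpTF (TF i) V z₀ ρ)).E s old φ X) (funext fun j' => funext fun Y => funext fun ψ => ?_)
  rw [olderOf_apply, olderOf_apply]
  exact recTerm_interpTower_of_le L TF i V z₀ ρ g (Nat.le_of_lt_succ j'.2) Y ψ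

/-- **AT MOCK COUPLING `0` THE INTERPOLATION TOWER GENERATES THE VERTEX TOWER'S TERMS** (at `g_i := z₀`; for a coupling-blind centre at any `g_i`, next
lemma) — at EVERY level. [cite: Balaban1987RG1, (0.23) p.256 and (2.12)-(2.13) p.268; Balaban1988RG2Cluster, (2.13)-(2.14) pp.14-15] -/
theorem recTerm_interpTower_zero (TF : GenTermFun P 𝔸 M L) (i : ℕ) (V : TermFun P 𝔸 M i L) (z₀ : ℂ) (ρ : ℝ) (g : ℕ → ℂ) (j : ℕ)
    (X : (domSys P M j).Dom) (φ : CPair P 𝔸) :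
    recTerm (interpTower L TF i V z₀ ρ) (Function.update g i 0) j X φ = recTerm (vertexTower L TF i V) (Function.update g i z₀) j X φ := by
  refine recTerm_congr_steps _ _ j (fun k _ old ψ Y => ?_) X φ
  rcases eq_or_ne k i with rfl | hk
  · rw [interpTower_apply_self, vertexTower_apply_self, Function.update_self, Function.update_self]
    exact E_ofTerms_congr L Y fun Z s _ => interpTF_zero _ V z₀ ρ Z s old ψ
  · rw [interpTower_apply_of_ne L _ _ _ _ hk, vertexTower_apply_of_ne L _ _ hk, Function.update_of_ne hk, Function.update_of_ne hk]

/-- … so with a coupling-blind centre: the vertex tower's terms at the UNCHANGED history. [cite: Balaban1987RG1, §1 p.263 and (2.13) p.268; Balaban1988RG2Cluster, (2.14) p.15] -/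
theorem recTerm_interpTower_zero_of_couplingBlind (TF : GenTermFun P 𝔸 M L) (i : ℕ) {V : TermFun P 𝔸 M i L} (hV : V.CouplingBlind) (z₀ : ℂ) (ρ : ℝ)
    (g : ℕ → ℂ) (j : ℕ) (X : (domSys P M j).Dom) (φ : CPair P 𝔸) :
    recTerm (interpTower L TF i V z₀ ρ) (Function.update g i 0) j X φ = recTerm (vertexTower L TF i V) g j X φ :=
  (recTerm_interpTower_zero L TF i V z₀ ρ g j X φ).trans (recTerm_vertexTower_updateHist L TF i hV g z₀ j X φ)

/-- **AT MOCK COUPLING `ρ` THE INTERPOLATION TOWER GENERATES THE ACTUAL TERMS AT `g_i := z₀`** — at EVERY level: with `recTerm_interpTower_zero` a Cauchy ∕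
Taylor estimate in the mock coupling on `[0, ρ]` compares actual and vertex terms level by level.
[cite: Balaban1987RG1, (0.23) p.256, §1 p.263 and (2.12)-(2.13) p.268; Balaban1988RG2Cluster, (2.13)-(2.14) pp.14-15] -/
theorem recTerm_interpTower_self (TF : GenTermFun P 𝔸 M L) (i : ℕ) (V : TermFun P 𝔸 M i L) (z₀ : ℂ) {ρ : ℝ} (hρ : ρ ≠ 0) (g : ℕ → ℂ) (j : ℕ)
    (X : (domSys P M j).Dom) (φ : CPair P 𝔸) :
    recTerm (interpTower L TF i V z₀ ρ) (Function.update g i (ρ : ℂ)) j X φ = recTerm (GenTower.ofTerms L TF) (Function.update g i z₀) j X φ := by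
  refine recTerm_congr_steps _ _ j (fun k _ old ψ Y => ?_) X φ
  rcases eq_or_ne k i with rfl | hk
  · rw [interpTower_apply_self, GenTower.ofTerms_apply, Function.update_self, Function.update_self]
    exact E_ofTerms_congr L Y fun Z s _ => interpTF_self _ V z₀ hρ Z s old ψ
  · rw [interpTower_apply_of_ne L _ _ _ _ hk, GenTower.ofTerms_apply, Function.update_of_ne hk, Function.update_of_ne hk]

end Interp

/-! ## §5  Why the centre is data: a centred order-two letter on the window determines its centre -/

section Centre

/-- **A CENTRED ORDER-TWO LETTER DETERMINES ITS CENTRE**: if `‖f t − e₀‖ ≤ M_w·t²` on the window `]0, γ]` then `f t → e₀` as `t → 0⁺` — so the centre of a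
centred comparison of the sections `g_{j−1} ↦ E^{(j)}` is their window limit, not a free-standing evaluation (adapted from the cell's lens memo, T13′).
[cite: Balaban1987RG1, §1 p.263 (the window g_{j-1} in [0, gamma]) and (1.18) p.263] -/
theorem tendsto_of_centredLetter {f : ℂ → ℂ} {e₀ : ℂ} {γ Mw : ℝ} (hγ : 0 < γ) (h : ∀ t ∈ Set.Ioc (0:ℝ) γ, ‖f t - e₀‖ ≤ Mw * t ^ 2) :
    Filter.Tendsto (fun t : ℝ => f t) (nhdsWithin 0 (Set.Ioi 0)) (nhds e₀) := by
  rw [Metric.tendsto_nhdsWithin_nhds]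
  intro ε hε
  have hM1 : 0 < |Mw| + 1 := by positivity
  refine ⟨min γ (min 1 (ε / (|Mw| + 1))), lt_min hγ (lt_min one_pos (div_pos hε hM1)), fun t ht hdist => ?_⟩
  have ht0 : 0 < t := ht
  rw [Real.dist_eq, sub_zero, abs_of_pos ht0] at hdist
  have htγ : t ≤ γ := (lt_of_lt_of_le hdist (min_le_left _ _)).le
  have ht1 : t < 1 := lt_of_lt_of_le hdist ((min_le_right _ _).trans (min_le_left _ _))
  have htε : t < ε / (|Mw| + 1) := lt_of_lt_of_le hdist ((min_le_right _ _).trans (min_le_right _ _))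
  have hkey : (|Mw| + 1) * (ε / (|Mw| + 1)) = ε := by field_simp
  rw [dist_eq_norm]
  calc ‖f t - e₀‖ ≤ Mw * t ^ 2 := h t ⟨ht0, htγ⟩
    _ ≤ |Mw| * t ^ 2 := mul_le_mul_of_nonneg_right (le_abs_self Mw) (sq_nonneg t)
    _ ≤ |Mw| * t := mul_le_mul_of_nonneg_left (by nlinarith [ht0, ht1]) (abs_nonneg Mw)
    _ ≤ (|Mw| + 1) * t := by linarith [ht0]
    _ < (|Mw| + 1) * (ε / (|Mw| + 1)) := mul_lt_mul_of_pos_left htε hM1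
    _ = ε := hkey

/-- **SO TWO CENTRES OF ONE SECTION COINCIDE** — a letter centred at a value other than the window limit (e.g. a junk evaluation at zero coupling) is
uninhabitable. [cite: Balaban1987RG1, §1 p.263 (the window) and (1.18) p.263] -/
theorem centre_unique {f : ℂ → ℂ} {e₀ e₁ : ℂ} {γ Mw Mw' : ℝ} (hγ : 0 < γ) (h₀ : ∀ t ∈ Set.Ioc (0:ℝ) γ, ‖f t - e₀‖ ≤ Mw * t ^ 2)
    (h₁ : ∀ t ∈ Set.Ioc (0:ℝ) γ, ‖f t - e₁‖ ≤ Mw' * t ^ 2) : e₀ = e₁ :=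
  tendsto_nhds_unique (tendsto_of_centredLetter hγ h₀) (tendsto_of_centredLetter hγ h₁)

end Centre

end W1

end Literature.MathematicalPhysics.QuantumFieldTheory.Balaban1983to89.Node00
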